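import Mathlib
import HarnessLib
import Literature.MathematicalPhysics.KineticTheory.LangevinChainGibbs

/-!
# Insertion identity toolbox, Ia: pointwise calculus of the coordinate derivatives

Support file for stub `stub_insertionIdentity` of the line `thermalise-then-cut-probe-insertion`
(crux `stmt-AtomisticToContinuum-11748`, `JunctionLocality.SuperadditiveResistance`): Leibniz and chain
rules for the coordinate derivatives `partialP`, `partialQ` of `FouriersLaw.lean`, for the
Ornstein–Uhlenbeck thermostat `S_i = T∂²_{p_i} − p_i∂_{p_i}`, the Liouville operator `X_H` and the
weighted Langevin generator `X_H + ∑ c_i S_i` (plain chain: `c = γ(𝟙_0 + 𝟙_{L−1})`; the probed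
device adds `γ` on the two junction momenta) — all written inline (local notations, no
definitions, so that the file is usable next to any copy of the line's vocabulary); derivative
bounds for Mathlib's `Real.smoothTransition`. All [folklore].
-/

noncomputable section

open scoped ContDiff Topology ENNReal NNReal Convolution Pointwise
open MeasureTheory ProbabilityTheory Filter Set Function
open Literature.MathematicalPhysics.KineticTheory.HeatConduction

namespace Summit.AtomisticToContinuum.FouriersLaw.Cruxes.SuperadditiveResistance.InsertionToolbox

local notation "uP" i' => ((0, Pi.single i' 1) : PhaseSpace _)
local notation "uQ" i' => ((Pi.single i' 1, 0) : PhaseSpace _)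

local notation "OU⟦" T' ";" i' ";" f' ";" x' "⟧" =>
  T' * partialP i' (partialP i' f') x' - Prod.snd (x' : PhaseSpace _) i' * partialP i' f' x'
local notation "XH⟦" P' ";" f' ";" x' "⟧" =>
  ∑ i, (Prod.snd (x' : PhaseSpace _) i * partialQ i f' x' -
    partialQ i (OscillatorChain.hamiltonian P' _) x' * partialP i f' x')
local notation "GEN⟦" P' ";" T' ";" c' ";" f' ";" x' "⟧" =>
  XH⟦P' ; f' ; x'⟧ + ∑ i, c' i * OU⟦T' ; i ; f' ; x'⟧
local notation "CUT⟦" ω₂' ";" lam' ";" β' ";" γ' ";" n' ";" x' "⟧" =>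
  Real.smoothTransition (2 - OscillatorChain.hamiltonian (pinnedChain ω₂' lam' β' γ') _ x' / ((n' : ℝ) + 1))

variable {L : ℕ}

/-! ### `partialP`, `partialQ` through `fderiv` -/

/-- For differentiable `f`, `∂_{p_i} f = Df · (0, e_i)` pointwise. [folklore] -/
theorem partialP_apply {f : PhaseSpace L → ℝ} (hf : Differentiable ℝ f) (i : Fin L)
    (x : PhaseSpace L) : partialP i f x = fderiv ℝ f x (uP i) := by
  rw [partialP_eq_fderiv hf]

/-- For differentiable `f`, `∂_{q_i} f = Df · (e_i, 0)` pointwise. [folklore] -/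
theorem partialQ_apply {f : PhaseSpace L → ℝ} (hf : Differentiable ℝ f) (i : Fin L)
    (x : PhaseSpace L) : partialQ i f x = fderiv ℝ f x (uQ i) := by
  rw [partialQ_eq_fderiv hf]

/-- Leibniz rule for `∂_{p_i}`. [folklore] -/
theorem partialP_mul {f g : PhaseSpace L → ℝ} (hf : Differentiable ℝ f) (hg : Differentiable ℝ g)
    (i : Fin L) (x : PhaseSpace L) :
    partialP i (fun y => f y * g y) x = f x * partialP i g x + g x * partialP i f x := by
  rw [partialP_apply (f := fun y => f y * g y) (hf.mul hg), partialP_apply hf, partialP_apply hg,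
    fderiv_fun_mul (hf x) (hg x)]
  simp

/-- Leibniz rule for `∂_{q_i}`. [folklore] -/
theorem partialQ_mul {f g : PhaseSpace L → ℝ} (hf : Differentiable ℝ f) (hg : Differentiable ℝ g)
    (i : Fin L) (x : PhaseSpace L) :
    partialQ i (fun y => f y * g y) x = f x * partialQ i g x + g x * partialQ i f x := by
  rw [partialQ_apply (f := fun y => f y * g y) (hf.mul hg), partialQ_apply hf, partialQ_apply hg,
    fderiv_fun_mul (hf x) (hg x)]
  simp

/-- `∂_{p_i}` is additive. [folklore] -/
theorem partialP_add {f g : PhaseSpace L → ℝ} (hf : Differentiable ℝ f) (hg : Differentiable ℝ g)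
    (i : Fin L) (x : PhaseSpace L) :
    partialP i (fun y => f y + g y) x = partialP i f x + partialP i g x := by
  rw [partialP_apply (f := fun y => f y + g y) (hf.add hg), partialP_apply hf, partialP_apply hg,
    fderiv_fun_add (hf x) (hg x)]
  simp

/-- `∂_{p_i}` commutes with scalars. [folklore] -/
theorem partialP_const_mul {f : PhaseSpace L → ℝ} (hf : Differentiable ℝ f) (c : ℝ)
    (i : Fin L) (x : PhaseSpace L) :
    partialP i (fun y => c * f y) x = c * partialP i f x := by
  rw [partialP_apply (hf.const_mul c), partialP_apply hf, fderiv_const_mul (hf x)]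
  simp

/-- `∂_{p_i}` kills constants. [folklore] -/
@[simp] theorem partialP_const (c : ℝ) (i : Fin L) (x : PhaseSpace L) :
    partialP i (fun _ => c) x = 0 := by
  simp [partialP]

/-- `∂_{q_i}` kills constants. [folklore] -/
@[simp] theorem partialQ_const (c : ℝ) (i : Fin L) (x : PhaseSpace L) :
    partialQ i (fun _ => c) x = 0 := by
  simp [partialQ]

/-- Chain rule for `∂_{p_i}` with an outer function of one variable. [folklore] -/
theorem partialP_comp {φ : ℝ → ℝ} {f : PhaseSpace L → ℝ} (hφ : Differentiable ℝ φ)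
    (hf : Differentiable ℝ f) (i : Fin L) (x : PhaseSpace L) :
    partialP i (fun y => φ (f y)) x = deriv φ (f x) * partialP i f x := by
  have hc : Differentiable ℝ fun y => φ (f y) := hφ.comp hf
  rw [partialP_apply hc, partialP_apply hf]
  have h := ((hφ (f x)).hasDerivAt.comp_hasFDerivAt x (hf x).hasFDerivAt).fderiv
  rw [Function.comp_def] at h
  rw [h]
  simp [smul_eq_mul]

/-- Chain rule for `∂_{q_i}` with an outer function of one variable. [folklore] -/
theorem partialQ_comp {φ : ℝ → ℝ} {f : PhaseSpace L → ℝ} (hφ : Differentiable ℝ φ)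
    (hf : Differentiable ℝ f) (i : Fin L) (x : PhaseSpace L) :
    partialQ i (fun y => φ (f y)) x = deriv φ (f x) * partialQ i f x := by
  have hc : Differentiable ℝ fun y => φ (f y) := hφ.comp hf
  rw [partialQ_apply hc, partialQ_apply hf]
  have h := ((hφ (f x)).hasDerivAt.comp_hasFDerivAt x (hf x).hasFDerivAt).fderiv
  rw [Function.comp_def] at h
  rw [h]
  simp [smul_eq_mul]

/-- `∂_{p_i} p_j = δ_{ij}`. [folklore] -/
@[simp] theorem partialP_snd (i j : Fin L) (x : PhaseSpace L) :
    partialP i (fun y => y.2 j) x = if j = i then 1 else 0 := by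
  unfold partialP
  by_cases h : j = i
  · subst h
    simp
  · simp [h]

/-- `∂_{p_i} q_j = 0`. [folklore] -/
@[simp] theorem partialP_fst (i j : Fin L) (x : PhaseSpace L) :
    partialP i (fun y => y.1 j) x = 0 := by
  simp [partialP]

/-- `∂_{q_i} q_j = δ_{ij}`. [folklore] -/
@[simp] theorem partialQ_fst (i j : Fin L) (x : PhaseSpace L) :
    partialQ i (fun y => y.1 j) x = if j = i then 1 else 0 := by
  unfold partialQ
  by_cases h : j = i
  · subst h
    simp
  · simp [h]

/-- `∂_{q_i} p_j = 0`. [folklore] -/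
@[simp] theorem partialQ_snd (i j : Fin L) (x : PhaseSpace L) :
    partialQ i (fun y => y.2 j) x = 0 := by
  simp [partialQ]

/-! ### Regularity bookkeeping -/

/-- For `f ∈ C^{m+1}`, `∂_{q_i} f ∈ C^m`. [folklore] -/
theorem contDiff_partialQ {f : PhaseSpace L → ℝ} {m n : WithTop ℕ∞} (hf : ContDiff ℝ n f)
    (hmn : m + 1 ≤ n) (i : Fin L) : ContDiff ℝ m (partialQ i f) := by
  have hn : n ≠ 0 := by
    rintro rfl
    exact absurd hmn (by simp)
  rw [partialQ_eq_fderiv (hf.differentiable hn)]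
  exact (hf.fderiv_right hmn).clm_apply contDiff_const

/-- For `f ∈ C²`, `∂_{p_i} f` is differentiable. [folklore] -/
theorem differentiable_partialP_of_contDiff_two {f : PhaseSpace L → ℝ} (hf : ContDiff ℝ 2 f)
    (i : Fin L) : Differentiable ℝ (partialP i f) :=
  (contDiff_partialP hf (m := 1) (by norm_num) i).differentiable one_ne_zero

/-- The coordinate `p_j` is smooth. [folklore] -/
theorem contDiff_snd_apply (j : Fin L) {n : WithTop ℕ∞} :
    ContDiff ℝ n fun x : PhaseSpace L => x.2 j :=
  (contDiff_apply ℝ ℝ j).comp contDiff_snd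

/-! ### The operators (written inline; this file introduces no definitions)

* `OU⟦T; i; f; x⟧ = T ∂²_{p_i} f (x) − p_i ∂_{p_i} f (x)` — the Ornstein–Uhlenbeck thermostat of
  temperature `T` on `p_i`;
* `XH⟦P; f; x⟧ = ∑_i (p_i ∂_{q_i} f − ∂_{q_i}H ∂_{p_i} f)(x)` — the Liouville operator;
* `GEN⟦P; T; c; f; x⟧ = XH f + ∑_i c_i OU_i f` — the Langevin generator with thermostat weights
  `c : Fin L → ℝ`, all thermostats at temperature `T` (plain chain: `c = γ(𝟙_0 + 𝟙_{L−1})`;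
  the probed device adds `γ 𝟙_K`).
-/

variable (P : OscillatorChain)

/-- The generator of `FouriersLaw.lean` at equal bath temperatures is the weighted generator
with the plain weights `c_i = γ([i = 0] + [i = L−1])`. [folklore] -/
theorem generator_eq_weighted (L : ℕ) (T : ℝ) (f : PhaseSpace L → ℝ) (x : PhaseSpace L) :
    P.generator L T T f x =
      GEN⟦P ; T ; fun i : Fin L =>
        P.γ * ((if i.val = 0 then 1 else 0) + (if i.val = L - 1 then 1 else 0)) ; f ; x⟧ := by
  simp only [OscillatorChain.generator, Finset.mul_sum]
  congr 1
  refine Finset.sum_congr rfl fun i _ => ?_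
  split_ifs <;> ring

/-! ### Leibniz rules -/

/-- Leibniz rule for the Liouville operator (a derivation). [folklore] -/
theorem liouville_mul {f g : PhaseSpace L → ℝ} (hf : Differentiable ℝ f)
    (hg : Differentiable ℝ g) (x : PhaseSpace L) :
    XH⟦P ; fun y => f y * g y ; x⟧ = f x * XH⟦P ; g ; x⟧ + g x * XH⟦P ; f ; x⟧ := by
  simp only [partialP_mul hf hg, partialQ_mul hf hg, Finset.mul_sum, ← Finset.sum_add_distrib]
  refine Finset.sum_congr rfl fun i _ => ?_
  ring

/-- Leibniz rule for the thermostat: `S(fg) = f Sg + g Sf + 2T ∂f ∂g` (the carré du champ).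
[folklore] -/
theorem ou_mul {T : ℝ} {f g : PhaseSpace L → ℝ} (hf : ContDiff ℝ 2 f) (hg : ContDiff ℝ 2 g)
    (i : Fin L) (x : PhaseSpace L) :
    OU⟦T ; i ; fun y => f y * g y ; x⟧ =
      f x * OU⟦T ; i ; g ; x⟧ + g x * OU⟦T ; i ; f ; x⟧ + 2 * T * (partialP i f x * partialP i g x) := by
  have hfd : Differentiable ℝ f := hf.differentiable two_ne_zero
  have hgd : Differentiable ℝ g := hg.differentiable two_ne_zero
  have hfp := differentiable_partialP_of_contDiff_two hf i
  have hgp := differentiable_partialP_of_contDiff_two hg i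
  have h1 : partialP i (fun y => f y * g y) = fun y => f y * partialP i g y + g y * partialP i f y :=
    funext fun y => partialP_mul hfd hgd i y
  simp only [h1]
  rw [partialP_add (f := fun y => f y * partialP i g y) (g := fun y => g y * partialP i f y)
      (hfd.mul hgp) (hgd.mul hfp), partialP_mul hfd hgp, partialP_mul hgd hfp]
  ring

/-- The thermostat is additive (`f, g ∈ C²`). [folklore] -/
theorem ou_add {T : ℝ} {f g : PhaseSpace L → ℝ} (hf : ContDiff ℝ 2 f) (hg : ContDiff ℝ 2 g)
    (i : Fin L) (x : PhaseSpace L) :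
    OU⟦T ; i ; fun y => f y + g y ; x⟧ = OU⟦T ; i ; f ; x⟧ + OU⟦T ; i ; g ; x⟧ := by
  have hfd : Differentiable ℝ f := hf.differentiable two_ne_zero
  have hgd : Differentiable ℝ g := hg.differentiable two_ne_zero
  have h1 : partialP i (fun y => f y + g y) = fun y => partialP i f y + partialP i g y :=
    funext fun y => partialP_add hfd hgd i y
  simp only [h1]
  rw [partialP_add (differentiable_partialP_of_contDiff_two hf i)
    (differentiable_partialP_of_contDiff_two hg i)]
  ring

/-- The thermostat commutes with scalars (`f ∈ C²`). [folklore] -/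
theorem ou_const_mul {T : ℝ} {f : PhaseSpace L → ℝ} (hf : ContDiff ℝ 2 f) (a : ℝ) (i : Fin L)
    (x : PhaseSpace L) :
    OU⟦T ; i ; fun y => a * f y ; x⟧ = a * OU⟦T ; i ; f ; x⟧ := by
  have hfd : Differentiable ℝ f := hf.differentiable two_ne_zero
  have h1 : partialP i (fun y => a * f y) = fun y => a * partialP i f y :=
    funext fun y => partialP_const_mul hfd a i y
  simp only [h1]
  rw [partialP_const_mul (differentiable_partialP_of_contDiff_two hf i)]
  ring

/-- Leibniz rule for the weighted generator: `𝓛(fg) = f 𝓛g + g 𝓛f + 2T ∑ c_i ∂_i f ∂_i g`.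
[folklore] -/
theorem gen_mul {T : ℝ} (c : Fin L → ℝ) {f g : PhaseSpace L → ℝ} (hf : ContDiff ℝ 2 f)
    (hg : ContDiff ℝ 2 g) (x : PhaseSpace L) :
    GEN⟦P ; T ; c ; fun y => f y * g y ; x⟧ =
      f x * GEN⟦P ; T ; c ; g ; x⟧ + g x * GEN⟦P ; T ; c ; f ; x⟧ +
        2 * T * ∑ i, c i * (partialP i f x * partialP i g x) := by
  rw [liouville_mul P (hf.differentiable two_ne_zero) (hg.differentiable two_ne_zero)]
  simp only [ou_mul hf hg]
  have key : ∑ i, c i * (f x * OU⟦T ; i ; g ; x⟧ + g x * OU⟦T ; i ; f ; x⟧ +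
      2 * T * (partialP i f x * partialP i g x)) =
      f x * ∑ i, c i * OU⟦T ; i ; g ; x⟧ + g x * ∑ i, c i * OU⟦T ; i ; f ; x⟧ +
        2 * T * ∑ i, c i * (partialP i f x * partialP i g x) := by
    simp only [Finset.mul_sum, ← Finset.sum_add_distrib]
    exact Finset.sum_congr rfl fun i _ => by ring
  rw [key]
  ring

/-! ### Chain rules -/

/-- Chain rule for the Liouville operator. [folklore] -/
theorem liouville_comp {φ : ℝ → ℝ} {f : PhaseSpace L → ℝ} (hφ : Differentiable ℝ φ)
    (hf : Differentiable ℝ f) (x : PhaseSpace L) :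
    XH⟦P ; fun y => φ (f y) ; x⟧ = deriv φ (f x) * XH⟦P ; f ; x⟧ := by
  simp only [partialP_comp hφ hf, partialQ_comp hφ hf, Finset.mul_sum]
  refine Finset.sum_congr rfl fun i _ => ?_
  ring

/-- `X_H H = 0` (energy conservation of the Hamiltonian flow; `∂_{p_i} H = p_i` needs no
hypothesis). [folklore] -/
theorem liouville_hamiltonian (x : PhaseSpace L) : XH⟦P ; P.hamiltonian L ; x⟧ = 0 := by
  simp only [OscillatorChain.partialP_hamiltonian]
  exact Finset.sum_eq_zero fun i _ => by ring

/-- Chain rule for the thermostat: `S(φ∘f) = φ'(f) Sf + T φ''(f) (∂f)²`. [folklore] -/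
theorem ou_comp {T : ℝ} {φ : ℝ → ℝ} {f : PhaseSpace L → ℝ} (hφ : ContDiff ℝ 2 φ)
    (hf : ContDiff ℝ 2 f) (i : Fin L) (x : PhaseSpace L) :
    OU⟦T ; i ; fun y => φ (f y) ; x⟧ =
      deriv φ (f x) * OU⟦T ; i ; f ; x⟧ + T * deriv (deriv φ) (f x) * partialP i f x ^ 2 := by
  have hφd : Differentiable ℝ φ := hφ.differentiable two_ne_zero
  have hfd : Differentiable ℝ f := hf.differentiable two_ne_zero
  have hφ' : Differentiable ℝ (deriv φ) := by
    have := hφ.iterate_deriv' 1 1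
    simpa using this.differentiable one_ne_zero
  have hfp := differentiable_partialP_of_contDiff_two hf i
  have h1 : partialP i (fun y => φ (f y)) = fun y => deriv φ (f y) * partialP i f y :=
    funext fun y => partialP_comp hφd hfd i y
  simp only [h1]
  rw [partialP_mul (f := fun y => deriv φ (f y)) (hφ'.comp hfd) hfp,
    partialP_comp (f := f) hφ' hfd]
  ring

/-- Chain rule for the weighted generator. [folklore] -/
theorem gen_comp {T : ℝ} (c : Fin L → ℝ) {φ : ℝ → ℝ} {f : PhaseSpace L → ℝ}
    (hφ : ContDiff ℝ 2 φ) (hf : ContDiff ℝ 2 f) (x : PhaseSpace L) :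
    GEN⟦P ; T ; c ; fun y => φ (f y) ; x⟧ =
      deriv φ (f x) * GEN⟦P ; T ; c ; f ; x⟧ +
        T * deriv (deriv φ) (f x) * ∑ i, c i * partialP i f x ^ 2 := by
  rw [liouville_comp P (hφ.differentiable two_ne_zero) (hf.differentiable two_ne_zero)]
  simp only [ou_comp hφ hf]
  have key : ∑ i, c i * (deriv φ (f x) * OU⟦T ; i ; f ; x⟧ +
      T * deriv (deriv φ) (f x) * partialP i f x ^ 2) =
      deriv φ (f x) * ∑ i, c i * OU⟦T ; i ; f ; x⟧ +
        T * deriv (deriv φ) (f x) * ∑ i, c i * partialP i f x ^ 2 := by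
    simp only [Finset.mul_sum, ← Finset.sum_add_distrib]
    exact Finset.sum_congr rfl fun i _ => by ring
  rw [key]
  ring

/-- `(T∂²_{p_i} − p_i∂_{p_i}) H = T − p_i²`. [folklore] -/
theorem ou_hamiltonian (T : ℝ) (i : Fin L) (x : PhaseSpace L) :
    OU⟦T ; i ; P.hamiltonian L ; x⟧ = T - x.2 i ^ 2 := by
  have h : partialP i (P.hamiltonian L) = fun y => y.2 i :=
    funext fun y => P.partialP_hamiltonian L y i
  simp only [h, partialP_snd, if_true]
  ring

/-- `𝓛 H = ∑_i c_i (T − p_i²)`: only the thermostats act on the energy. [folklore] -/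
theorem gen_hamiltonian (T : ℝ) (c : Fin L → ℝ) (x : PhaseSpace L) :
    GEN⟦P ; T ; c ; P.hamiltonian L ; x⟧ = ∑ i, c i * (T - x.2 i ^ 2) := by
  rw [liouville_hamiltonian, zero_add]
  exact Finset.sum_congr rfl fun i _ => by rw [ou_hamiltonian]

/-! ### Smooth transition: derivative bounds

The cutoffs below are `χ_n = sT(2 − H/(n+1))` with Mathlib's `Real.smoothTransition` (`sT = 0` on
`(−∞, 0]`, `sT = 1` on `[1, ∞)`, smooth, values in `[0, 1]`).
-/

/-- `sT'` vanishes off `[0, 1]`. [folklore] -/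
theorem deriv_smoothTransition_eq_zero {s : ℝ} (hs : s < 0 ∨ 1 < s) :
    deriv Real.smoothTransition s = 0 := by
  rcases hs with hs | hs
  · have : Real.smoothTransition =ᶠ[𝓝 s] fun _ => (0 : ℝ) := by
      filter_upwards [Iio_mem_nhds hs] with t ht
      exact Real.smoothTransition.zero_of_nonpos ht.le
    rw [this.deriv_eq]
    simp
  · have : Real.smoothTransition =ᶠ[𝓝 s] fun _ => (1 : ℝ) := by
      filter_upwards [Ioi_mem_nhds hs] with t ht
      exact Real.smoothTransition.one_of_one_le ht.le
    rw [this.deriv_eq]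
    simp

/-- `sT''` vanishes off `[0, 1]`. [folklore] -/
theorem deriv_deriv_smoothTransition_eq_zero {s : ℝ} (hs : s < 0 ∨ 1 < s) :
    deriv (deriv Real.smoothTransition) s = 0 := by
  have : deriv Real.smoothTransition =ᶠ[𝓝 s] fun _ => (0 : ℝ) := by
    rcases hs with hs | hs
    · filter_upwards [Iio_mem_nhds hs] with t ht
      exact deriv_smoothTransition_eq_zero (Or.inl ht)
    · filter_upwards [Ioi_mem_nhds hs] with t ht
      exact deriv_smoothTransition_eq_zero (Or.inr ht)
  rw [this.deriv_eq]
  simp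

/-- `sT` is `C^∞`. [folklore] -/
theorem contDiff_smoothTransition_infty : ContDiff ℝ ∞ Real.smoothTransition :=
  Real.smoothTransition.contDiff (n := ⊤)

/-- `sT'` and `sT''` are bounded. [folklore] -/
theorem exists_bound_deriv_smoothTransition :
    ∃ M : ℝ, 0 ≤ M ∧ (∀ s, |deriv Real.smoothTransition s| ≤ M) ∧
      ∀ s, |deriv (deriv Real.smoothTransition) s| ≤ M := by
  have h1 : Continuous (deriv Real.smoothTransition) :=
    contDiff_smoothTransition_infty.continuous_deriv (by simp)
  have h2 : Continuous (deriv (deriv Real.smoothTransition)) := by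
    have := (Real.smoothTransition.contDiff (n := 2)).iterate_deriv' 1 1
    simpa using (this.continuous_deriv (by simp))
  have hK : IsCompact (Set.Icc (0 : ℝ) 1) := isCompact_Icc
  have hs1 : HasCompactSupport (deriv Real.smoothTransition) := by
    refine HasCompactSupport.intro hK fun s hs => ?_
    simp only [Set.mem_Icc, not_and_or, not_le] at hs
    exact deriv_smoothTransition_eq_zero hs
  have hs2 : HasCompactSupport (deriv (deriv Real.smoothTransition)) := by
    refine HasCompactSupport.intro hK fun s hs => ?_
    simp only [Set.mem_Icc, not_and_or, not_le] at hs
    exact deriv_deriv_smoothTransition_eq_zero hs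
  obtain ⟨C₁, hC₁⟩ := h1.bounded_above_of_compact_support hs1
  obtain ⟨C₂, hC₂⟩ := h2.bounded_above_of_compact_support hs2
  refine ⟨max (max C₁ C₂) 0, le_max_right _ _, fun s => ?_, fun s => ?_⟩
  · have := hC₁ s
    rw [Real.norm_eq_abs] at this
    exact this.trans ((le_max_left _ _).trans (le_max_left _ _))
  · have := hC₂ s
    rw [Real.norm_eq_abs] at this
    exact this.trans ((le_max_right _ _).trans (le_max_left _ _))

/-- Registered helper stub of this support file: the Leibniz rule for `∂_{p_i}`. [folklore] -/
theorem helper_insertionCalculus : ∀ {L : ℕ} {f g : PhaseSpace L → ℝ}, Differentiable ℝ f → Differentiable ℝ g → ∀ (i : Fin L) (x : PhaseSpace L), partialP i (fun y => f y * g y) x = f x * partialP i g x + g x * partialP i f x := by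
  intro L f g hf hg i x
  exact partialP_mul hf hg i x

end Summit.AtomisticToContinuum.FouriersLaw.Cruxes.SuperadditiveResistance.InsertionToolbox

end
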